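import Summits.QuantumAdvantage.AdviceFreeQNC0.CrossTeamEmbedding
import Summits.QuantumAdvantage.AdviceFreeQNC0.LogDegreeResidueBalance
import HarnessLib

/-!
# Cell qa-qnc0 (rung F-Q1, route RingFrame, crux α): the GAP LEMMA — a walk strategy that neither
# reads nor bets inside one window of `ℓ` input bits wins at most `(2/3)(1 + 2^{-ℓ})` of the inputs

Crux α (`RingHardU`, walk coordinates, tree `ringWinU`): `u ∈ {0,1}ⁿ`, positions `g = 0..n`,
selectors `y_g(u)`, `WIN(u) ⟺ #{g : y_g(u) ∧ c + g + |u| + W_g(u) ≢ 0 (mod 3)}` odd.  The END BET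
(select the last position only) wins on `2/3` of the inputs; every theorem of the cell so far bounds
strategies of LOW DEGREE with FEW clusters (ends / one / two interior windows, `θ = 1 − η_t` with
`η_t` tiny: `EndSupportedStrategies`, `OneWindowStrategies`, `TwoWindowStrategies`, and qn-prover-3's
general window ladder).

This file proves a DEGREE-FREE bound with the SHARP constant for a structurally different class.
Write the input as three glued blocks `u = a ++ v ++ b` (`|a| = p`, `|v| = ℓ`, `|b| = q`;
`glue3`).  Suppose the strategy

* never selects a position strictly inside the window: `y_g ≡ false` for `p < g < p + ℓ`, and
* does not read the window: `y_g(a ++ v ++ b)` is independent of `v`.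

Then (`ringWinU_cleanGap_le`)

  `3 · #{u : WIN(u)} ≤ 2 · 2ⁿ + 2 · 2^{p+q}`,  i.e.  `P[WIN] ≤ (2/3)(1 + 2^{−ℓ})`.

No degree hypothesis at all; the end bet shows the constant `2/3` cannot be improved.

Proof (`gapChar`, `gapCount`, `ringWinU_glue3_iff`, `exists_gapCount_even`).  Condition on the
outside blocks `a, b` and put `w = |v|`.  A selected position `g ≤ p` has character
`c + g + (|a| + w + |b|) + W_g(a) = A_g + w`; a selected position `g ≥ p + ℓ` has character
`c + g + (|a| + w + |b|) + (|a| + w + W_{g−p−ℓ}(b)) = C_g + 2w`.  So `WIN` depends on `v` only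
through `w mod 3`, and as `r` ranges over `ℤ/3` each selected position's character `A_g + r`, resp.
`C_g + 2r`, is non-zero for EXACTLY two values of `r`: the three counts
`N(r) = #{g selected : character(r) ≢ 0}` sum to `2·#selected`, an even number, so they cannot
all be odd — for some residue `r₀` the strategy LOSES on every `v` with `|v| ≡ r₀`.  The class
`{v ∈ {0,1}^ℓ : |v| ≡ r₀ (3)}` has at least `(2^ℓ − 2)/3` elements (`three_mul_card_class_add_two_ge`,
from the character identity `Σ_v ω^{|v|} = (1+ω)^ℓ` of `LogDegreeResidueBalance`), whence the bound
fibre by fibre and Fubini over `(a, b)`.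

The cell's statement (prover qn-prover g3, 2026-08-26); not in print.  Companion instrument (kit
j255342, evidence on stmt-QuantumAdvantage-19119): for DENSE local rules (selectors = functions of
≤ 5 consecutive bits, no clean gap) an exact dynamic programme finds max `P[WIN] = 2/3` at
`n = 60…300` over 3 × 65 536 translation-invariant rules with optimised boundaries.
WHAT THIS IS NOT: nothing on GLOBAL low-degree selectors (that is α); no separation claim.
-/

noncomputable section

namespace Summit.QuantumAdvantage.AdviceFreeQNC0

open Finset
open Literature.Computability.MetaComplexity Literature.Computability.MetaComplexity.Smolensky

variable {p ℓ q : ℕ}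

/-! ### Three glued blocks -/

/-- The input glued from a prefix block `a`, a window `v` and a suffix block `b`. -/
def glue3 (a : Fin p → Bool) (v : Fin ℓ → Bool) (b : Fin q → Bool) : Fin (p + ℓ + q) → Bool :=
  Fin.append (Fin.append a v) b

/-- `|a ++ v ++ b| = |a| + |v| + |b|`. -/
theorem wt_glue3 (a : Fin p → Bool) (v : Fin ℓ → Bool) (b : Fin q → Bool) :
    wt (glue3 a v b) = wt a + wt v + wt b := by
  unfold glue3
  rw [wt_append, wt_append]

/-- Prefix weights before the window see only the prefix block. -/
theorem wtPrefix_glue3_of_le (a : Fin p → Bool) (v : Fin ℓ → Bool) (b : Fin q → Bool) {g : ℕ}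
    (hg : g ≤ p) : wtPrefix (glue3 a v b) g = wtPrefix a g := by
  unfold glue3
  rw [wtPrefix_append_of_le _ _ (by omega : g ≤ p + ℓ), wtPrefix_append_of_le _ _ hg]

/-- Prefix weights after the window contain the whole window weight. -/
theorem wtPrefix_glue3_of_ge (a : Fin p → Bool) (v : Fin ℓ → Bool) (b : Fin q → Bool) {g : ℕ}
    (hg : p + ℓ ≤ g) : wtPrefix (glue3 a v b) g = wt a + wt v + wtPrefix b (g - (p + ℓ)) := by
  unfold glue3
  rw [wtPrefix_append_of_ge _ _ hg, wt_append]

/-! ### The characters with the window weight as a parameter -/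

/-- The walk character of position `g` on `a ++ v ++ b` with the window weight replaced by the
parameter `r`: `A_g + r` before the window (`g ≤ p`), `C_g + 2r` after it. -/
def gapChar (ℓ c : ℕ) (a : Fin p → Bool) (b : Fin q → Bool) (g r : ℕ) : ℕ :=
  if g ≤ p then c + g + ((wt a + r + wt b) + wtPrefix a g)
  else c + g + ((wt a + r + wt b) + (wt a + r + wtPrefix b (g - (p + ℓ))))

/-- The selectors read off the outside blocks (window filled with zeros). -/
def gapSel (y : Fin (p + ℓ + q + 1) → (Fin (p + ℓ + q) → Bool) → Bool)
    (a : Fin p → Bool) (b : Fin q → Bool) (g : Fin (p + ℓ + q + 1)) : Bool :=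
  y g (glue3 a (fun _ => false) b)

/-- `N(r)` = number of selected positions whose character with window-weight parameter `r` is
non-zero mod `3`. -/
def gapCount (y : Fin (p + ℓ + q + 1) → (Fin (p + ℓ + q) → Bool) → Bool) (c : ℕ)
    (a : Fin p → Bool) (b : Fin q → Bool) (r : ℕ) : ℕ :=
  (univ.filter fun g : Fin (p + ℓ + q + 1) =>
    gapSel y a b g = true ∧ gapChar ℓ c a b g.val r % 3 ≠ 0).card

/-- The character mod `3` depends on the parameter only mod `3`. -/
theorem gapChar_mod (ℓ c : ℕ) (a : Fin p → Bool) (b : Fin q → Bool) (g r : ℕ) :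
    gapChar ℓ c a b g r % 3 = gapChar ℓ c a b g (r % 3) % 3 := by
  unfold gapChar
  split_ifs <;> omega

/-- Hence `N(r) = N(r mod 3)`. -/
theorem gapCount_mod (y : Fin (p + ℓ + q + 1) → (Fin (p + ℓ + q) → Bool) → Bool) (c : ℕ)
    (a : Fin p → Bool) (b : Fin q → Bool) (r : ℕ) :
    gapCount y c a b r = gapCount y c a b (r % 3) := by
  unfold gapCount
  congr 1
  refine Finset.filter_congr fun g _ => ?_
  rw [gapChar_mod ℓ c a b g.val r]

/-- For every position, EXACTLY two of the three parameter values give a non-zero character. -/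
theorem sum_range_three_gapChar_ne (ℓ c : ℕ) (a : Fin p → Bool) (b : Fin q → Bool) (g : ℕ) :
    ∑ r ∈ range 3, (if gapChar ℓ c a b g r % 3 ≠ 0 then 1 else 0) = 2 := by
  rw [Finset.sum_range_succ, Finset.sum_range_succ, Finset.sum_range_succ, Finset.sum_range_zero]
  unfold gapChar
  split_ifs <;> omega

/-! ### The win bit on a glued input -/

variable (c : ℕ) (y : Fin (p + ℓ + q + 1) → (Fin (p + ℓ + q) → Bool) → Bool)

/-- **The win bit through the window weight.**  If the strategy never selects a position strictly
inside the window and does not read the window, then on `a ++ v ++ b` it wins iff `N(|v|)` is odd. -/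
theorem ringWinU_glue3_iff
    (hgap : ∀ g : Fin (p + ℓ + q + 1), p < g.val → g.val < p + ℓ → ∀ w, y g w = false)
    (hloc : ∀ (g : Fin (p + ℓ + q + 1)) (a : Fin p → Bool) (v v' : Fin ℓ → Bool) (b : Fin q → Bool),
      y g (glue3 a v b) = y g (glue3 a v' b))
    (a : Fin p → Bool) (v : Fin ℓ → Bool) (b : Fin q → Bool) :
    ringWinU c y (glue3 a v b) = true ↔ gapCount y c a b (wt v) % 2 = 1 := by
  unfold ringWinU gapCount
  rw [decide_eq_true_iff]
  have hset : (univ.filter fun g : Fin (p + ℓ + q + 1) =>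
      y g (glue3 a v b) = true ∧ (c + g.val + walkExp (glue3 a v b) g.val) % 3 ≠ 0) =
      univ.filter fun g : Fin (p + ℓ + q + 1) =>
        gapSel y a b g = true ∧ gapChar ℓ c a b g.val (wt v) % 3 ≠ 0 := by
    refine Finset.filter_congr fun g _ => ?_
    have hsel : y g (glue3 a v b) = gapSel y a b g := hloc g a v (fun _ => false) b
    -- a selected position lies outside the open window
    have hout : gapSel y a b g = true → (g.val ≤ p ∨ p + ℓ ≤ g.val) := by
      intro h1
      by_contra hcon
      have hf := hgap g (by omega) (by omega) (glue3 a (fun _ => false) b)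
      unfold gapSel at h1
      rw [hf] at h1
      exact Bool.false_ne_true h1
    -- outside the open window the true character is `gapChar` at `r = |v|`
    have hchar : (g.val ≤ p ∨ p + ℓ ≤ g.val) →
        c + g.val + walkExp (glue3 a v b) g.val = gapChar ℓ c a b g.val (wt v) := by
      intro hg
      unfold walkExp gapChar
      by_cases hle : g.val ≤ p
      · rw [if_pos hle, wtPrefix_glue3_of_le a v b hle, wt_glue3]
      · rw [if_neg hle, wtPrefix_glue3_of_ge a v b (hg.resolve_left hle), wt_glue3]
    rw [hsel]
    constructor
    · rintro ⟨h1, h2⟩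
      exact ⟨h1, by rwa [← hchar (hout h1)]⟩
    · rintro ⟨h1, h2⟩
      exact ⟨h1, by rwa [hchar (hout h1)]⟩
  rw [hset]

/-! ### At most two of the three residues win -/

/-- **The parity obstruction with one unknown residue.**  `N(0) + N(1) + N(2) = 2·#selected` is
even, so some `N(r₀)` (`r₀ < 3`) is even: on every window content `v` with `|v| ≡ r₀ (mod 3)` the
strategy loses. -/
theorem exists_gapCount_even (a : Fin p → Bool) (b : Fin q → Bool) :
    ∃ r₀, r₀ < 3 ∧ gapCount y c a b r₀ % 2 = 0 := by
  set S := univ.filter fun g : Fin (p + ℓ + q + 1) => gapSel y a b g = true with hS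
  have hcount : ∀ r, gapCount y c a b r = ∑ g ∈ S, (if gapChar ℓ c a b g.val r % 3 ≠ 0 then 1 else 0) := by
    intro r
    unfold gapCount
    rw [hS, Finset.sum_filter, Finset.card_filter]
    refine Finset.sum_congr rfl fun g _ => ?_
    by_cases h1 : gapSel y a b g = true <;> by_cases h2 : gapChar ℓ c a b g.val r % 3 ≠ 0 <;> simp [h1, h2]
  have hsum : ∑ r ∈ range 3, gapCount y c a b r = S.card * 2 := by
    simp_rw [hcount]
    rw [Finset.sum_comm, Finset.sum_congr rfl fun g _ => sum_range_three_gapChar_ne ℓ c a b g.val,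
      Finset.sum_const, smul_eq_mul]
  rw [Finset.sum_range_succ, Finset.sum_range_succ, Finset.sum_range_succ, Finset.sum_range_zero] at hsum
  by_contra hcon
  simp only [not_exists, not_and] at hcon
  have h0 := hcon 0 (by norm_num)
  have h1 := hcon 1 (by norm_num)
  have h2 := hcon 2 (by norm_num)
  omega

/-! ### Residue classes of the window cube -/

/-- Every residue class of `{0,1}^ℓ` has at least `(2^ℓ − 2)/3` elements:
`3·#{v : |v| ≡ r (3)} + 2 ≥ 2^ℓ` (from `Σ_v ω^{|v|} = (1 + ω)^ℓ`, `|1 + ω| = 1`). -/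
theorem three_mul_card_class_add_two_ge (ℓ r : ℕ) :
    2 ^ ℓ ≤ 3 * (univ.filter fun v : Fin ℓ → Bool => wt v % 3 = r % 3).card + 2 := by
  have h := abs_three_mul_card_filter_mod_sub_card_le (univ : Finset (Fin ℓ → Bool)) r
  rw [norm_sum_omega3_pow_wt ℓ, Finset.card_univ, Fintype.card_fun, Fintype.card_bool,
    Fintype.card_fin] at h
  have hwt : ∀ v : Fin ℓ → Bool, Hegedus.wt v = wt v := fun v => rfl
  simp only [hwt] at h
  have h' := (abs_le.1 h).1
  have hcast : ((2 ^ ℓ : ℕ) : ℝ) ≤ (3 * (univ.filter fun v : Fin ℓ → Bool => wt v % 3 = r % 3).card + 2 : ℕ) := by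
    push_cast
    push_cast at h'
    linarith
  exact_mod_cast hcast

/-- On a fibre `{a ++ v ++ b : v}` the strategy wins on at most `2^ℓ − (2^ℓ − 2)/3` window contents:
`3·#{v : WIN(a ++ v ++ b)} ≤ 2·2^ℓ + 2`. -/
theorem three_mul_card_win_fibre_le
    (hgap : ∀ g : Fin (p + ℓ + q + 1), p < g.val → g.val < p + ℓ → ∀ w, y g w = false)
    (hloc : ∀ (g : Fin (p + ℓ + q + 1)) (a : Fin p → Bool) (v v' : Fin ℓ → Bool) (b : Fin q → Bool),
      y g (glue3 a v b) = y g (glue3 a v' b))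
    (a : Fin p → Bool) (b : Fin q → Bool) :
    3 * (univ.filter fun v : Fin ℓ → Bool => ringWinU c y (glue3 a v b) = true).card ≤
      2 * 2 ^ ℓ + 2 := by
  obtain ⟨r₀, hr₀, heven⟩ := exists_gapCount_even c y a b
  -- the winning window contents avoid the class `r₀`
  have hsub : (univ.filter fun v : Fin ℓ → Bool => ringWinU c y (glue3 a v b) = true) ⊆
      univ.filter fun v : Fin ℓ → Bool => ¬ (wt v % 3 = r₀ % 3) := by
    intro v hv
    simp only [Finset.mem_filter, Finset.mem_univ, true_and] at hv ⊢
    intro hclass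
    rw [ringWinU_glue3_iff c y hgap hloc, gapCount_mod, hclass, Nat.mod_eq_of_lt hr₀, heven] at hv
    exact absurd hv (by norm_num)
  have hcard := Finset.card_le_card hsub
  have hcompl : (univ.filter fun v : Fin ℓ → Bool => wt v % 3 = r₀ % 3).card +
      (univ.filter fun v : Fin ℓ → Bool => ¬ (wt v % 3 = r₀ % 3)).card = 2 ^ ℓ := by
    rw [Finset.card_filter_add_card_filter_not, Finset.card_univ, Fintype.card_fun,
      Fintype.card_bool, Fintype.card_fin]
  have hclass := three_mul_card_class_add_two_ge ℓ r₀
  omega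

/-! ### The gap lemma -/

/-- Fubini over the three blocks: a count over `{0,1}^{p+ℓ+q}` is the iterated count over
`(a, b)` and the window content `v`. -/
theorem card_filter_eq_sum_glue3 (P : (Fin (p + ℓ + q) → Bool) → Prop) [DecidablePred P] :
    (univ.filter fun w : Fin (p + ℓ + q) → Bool => P w).card =
      ∑ a : Fin p → Bool, ∑ b : Fin q → Bool,
        (univ.filter fun v : Fin ℓ → Bool => P (glue3 a v b)).card := by
  rw [Finset.card_filter]
  rw [← (Fin.appendEquiv (p + ℓ) q).sum_comp, Fintype.sum_prod_type]
  rw [← (Fin.appendEquiv p ℓ).sum_comp, Fintype.sum_prod_type]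
  refine Finset.sum_congr rfl fun a _ => ?_
  rw [Finset.sum_comm]
  refine Finset.sum_congr rfl fun b _ => ?_
  rw [Finset.card_filter]
  rfl

/-- **THE GAP LEMMA.**  A walk strategy on `n = p + ℓ + q` bits that never selects a position
strictly inside the window `(p, p + ℓ)` and whose selectors do not read the window bits wins on at
most `(2/3)(2ⁿ + 2^{p+q})` inputs: `3·#WIN ≤ 2·2ⁿ + 2·2^{p+q}`.  No degree hypothesis; sharp up to the
`2^{p+q}` term (the end bet wins on `2/3` of the inputs). -/
theorem ringWinU_cleanGap_le
    (hgap : ∀ g : Fin (p + ℓ + q + 1), p < g.val → g.val < p + ℓ → ∀ w, y g w = false)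
    (hloc : ∀ (g : Fin (p + ℓ + q + 1)) (a : Fin p → Bool) (v v' : Fin ℓ → Bool) (b : Fin q → Bool),
      y g (glue3 a v b) = y g (glue3 a v' b)) :
    3 * (univ.filter fun w : Fin (p + ℓ + q) → Bool => ringWinU c y w = true).card ≤
      2 * 2 ^ (p + ℓ + q) + 2 * 2 ^ (p + q) := by
  rw [card_filter_eq_sum_glue3, Finset.mul_sum]
  have hfib : ∀ a : Fin p → Bool, 3 * ∑ b : Fin q → Bool,
      (univ.filter fun v : Fin ℓ → Bool => ringWinU c y (glue3 a v b) = true).card ≤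
        2 ^ q * (2 * 2 ^ ℓ + 2) := by
    intro a
    rw [Finset.mul_sum]
    calc ∑ b : Fin q → Bool, 3 * (univ.filter fun v : Fin ℓ → Bool => ringWinU c y (glue3 a v b) = true).card
        ≤ ∑ _b : Fin q → Bool, (2 * 2 ^ ℓ + 2) :=
          Finset.sum_le_sum fun b _ => three_mul_card_win_fibre_le c y hgap hloc a b
      _ = 2 ^ q * (2 * 2 ^ ℓ + 2) := by
          rw [Finset.sum_const, Finset.card_univ, Fintype.card_fun, Fintype.card_bool,
            Fintype.card_fin, smul_eq_mul]
  calc ∑ a : Fin p → Bool, 3 * ∑ b : Fin q → Bool,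
        (univ.filter fun v : Fin ℓ → Bool => ringWinU c y (glue3 a v b) = true).card
      ≤ ∑ _a : Fin p → Bool, 2 ^ q * (2 * 2 ^ ℓ + 2) := Finset.sum_le_sum fun a _ => hfib a
    _ = 2 ^ p * (2 ^ q * (2 * 2 ^ ℓ + 2)) := by
        rw [Finset.sum_const, Finset.card_univ, Fintype.card_fun, Fintype.card_bool,
          Fintype.card_fin, smul_eq_mul]
    _ = 2 * 2 ^ (p + ℓ + q) + 2 * 2 ^ (p + q) := by ring

/-- The same bound as a real fraction: `#WIN ≤ (2/3)·(1 + 2^{−ℓ})·2ⁿ`. -/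
theorem card_ringWinU_cleanGap_le_real
    (hgap : ∀ g : Fin (p + ℓ + q + 1), p < g.val → g.val < p + ℓ → ∀ w, y g w = false)
    (hloc : ∀ (g : Fin (p + ℓ + q + 1)) (a : Fin p → Bool) (v v' : Fin ℓ → Bool) (b : Fin q → Bool),
      y g (glue3 a v b) = y g (glue3 a v' b)) :
    ((univ.filter fun w : Fin (p + ℓ + q) → Bool => ringWinU c y w = true).card : ℝ) ≤
      (2 / 3) * (1 + 1 / (2 : ℝ) ^ ℓ) * (2 : ℝ) ^ (p + ℓ + q) := by
  have h := ringWinU_cleanGap_le c y hgap hloc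
  have h' : (3 : ℝ) * ((univ.filter fun w : Fin (p + ℓ + q) → Bool => ringWinU c y w = true).card : ℝ) ≤
      2 * (2 : ℝ) ^ (p + ℓ + q) + 2 * (2 : ℝ) ^ (p + q) := by exact_mod_cast h
  have hpow : (2 : ℝ) ^ (p + ℓ + q) = (2 : ℝ) ^ (p + q) * (2 : ℝ) ^ ℓ := by
    rw [← pow_add]; ring_nf
  have hℓ : (0 : ℝ) < (2 : ℝ) ^ ℓ := by positivity
  rw [hpow] at h' ⊢
  field_simp
  nlinarith [h', hℓ]

/-! ### Sharpness: the end bet wins on `2/3` of the inputs -/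

/-- The END BET: select the last position only. -/
def endBet (n : ℕ) : Fin (n + 1) → (Fin n → Bool) → Bool := fun g _ => decide (g.val = n)

/-- The end bet wins at `u` iff `|u| + n + 1 ≢ 0 (mod 3)` (its only character is
`c + n + 2|u| = 2(n + 1 + |u|)` at the charge `c = n + 2`). -/
theorem ringWinU_endBet_iff (n : ℕ) (u : Fin n → Bool) :
    ringWinU (n + 2) (endBet n) u = true ↔ (wt u + n + 1) % 3 ≠ 0 := by
  unfold ringWinU endBet
  rw [decide_eq_true_iff]
  have hset : (univ.filter fun g : Fin (n + 1) =>
      decide (g.val = n) = true ∧ (n + 2 + g.val + walkExp u g.val) % 3 ≠ 0) =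
      if (wt u + n + 1) % 3 ≠ 0 then {Fin.last n} else ∅ := by
    ext g
    simp only [Finset.mem_filter, Finset.mem_univ, true_and, decide_eq_true_eq]
    have hwalk : walkExp u n = wt u + wt u := by
      unfold walkExp wtPrefix wt
      congr 1
      exact congrArg Finset.card (Finset.filter_congr fun i _ => by simp [i.isLt])
    constructor
    · rintro ⟨hg, hne⟩
      rw [hg, hwalk] at hne
      have hiff : (wt u + n + 1) % 3 ≠ 0 := by omega
      rw [if_pos hiff, Finset.mem_singleton]
      exact Fin.ext (by rw [hg, Fin.val_last])
    · intro hg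
      split_ifs at hg with hiff
      · rw [Finset.mem_singleton] at hg
        subst hg
        refine ⟨Fin.val_last n, ?_⟩
        rw [Fin.val_last, hwalk]
        omega
      · exact absurd hg (Finset.notMem_empty _)
  rw [hset]
  split_ifs with h
  · simp [h]
  · simp [h]

/-- **The end bet wins on at least `(2·2ⁿ − 2)/3` inputs** — the constant `2/3` of the gap lemma is
attained (by a strategy with every window clean). -/
theorem three_mul_card_ringWinU_endBet_ge (n : ℕ) :
    2 * 2 ^ n ≤ 3 * (univ.filter fun u : Fin n → Bool => ringWinU (n + 2) (endBet n) u = true).card + 2 := by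
  -- the losing inputs are one residue class of `|u|`
  obtain ⟨r, hr⟩ : ∃ r : ℕ, ∀ u : Fin n → Bool, ((wt u + n + 1) % 3 ≠ 0 ↔ ¬ (wt u % 3 = r % 3)) :=
    ⟨2 * (n + 1), fun u => by constructor <;> intro h <;> omega⟩
  have hset : (univ.filter fun u : Fin n → Bool => ringWinU (n + 2) (endBet n) u = true) =
      univ.filter fun u : Fin n → Bool => ¬ (wt u % 3 = r % 3) := by
    refine Finset.filter_congr fun u _ => ?_
    rw [ringWinU_endBet_iff, hr u]
  rw [hset]
  -- the class has at most `(2ⁿ + 2)/3` elements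
  have h := abs_three_mul_card_filter_mod_sub_card_le (univ : Finset (Fin n → Bool)) r
  rw [norm_sum_omega3_pow_wt n, Finset.card_univ, Fintype.card_fun, Fintype.card_bool,
    Fintype.card_fin] at h
  have hwt : ∀ v : Fin n → Bool, Hegedus.wt v = wt v := fun v => rfl
  simp only [hwt] at h
  have h' := (abs_le.1 h).2
  have hle : 3 * (univ.filter fun u : Fin n → Bool => wt u % 3 = r % 3).card ≤ 2 ^ n + 2 := by
    have hcast : (3 * (univ.filter fun u : Fin n → Bool => wt u % 3 = r % 3).card : ℕ) ≤ ((2 ^ n + 2 : ℕ) : ℝ) := by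
      push_cast
      push_cast at h'
      linarith
    exact_mod_cast hcast
  have hcompl : (univ.filter fun u : Fin n → Bool => wt u % 3 = r % 3).card +
      (univ.filter fun u : Fin n → Bool => ¬ (wt u % 3 = r % 3)).card = 2 ^ n := by
    rw [Finset.card_filter_add_card_filter_not, Finset.card_univ, Fintype.card_fun,
      Fintype.card_bool, Fintype.card_fin]
  omega

end Summit.QuantumAdvantage.AdviceFreeQNC0
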